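import Summits.ResolutionOfSingularities.ResolutionOfSingularities.Theorems.FrobeniusLadderFInjectiveMacaulayficationSigma3P2d4BPointFloorRowClass
import Summits.ResolutionOfSingularities.ResolutionOfSingularities.Theorems.FrobeniusLadderFInjectiveMacaulayficationF108ClassRowAnyField
import Mathlib.FieldTheory.IsAlgClosed.AlgebraicClosure
import HarnessLib

/-!
# GAP-2 «k ≠ k̄»: THE CENSUS BED P2d4B `z² + x²z + y³ + u³ + t⁵` (σ₃-shifted `f′ = z² + x²z + x⁵ + x⁶ + y³ + u³ + t⁵`) — POINT-FLOOR ROW AND GERM OVER ANY FIELD OF CHARACTERISTIC 2 (any-field twins of ✓ `…Sigma3P2d4BPointFloorRowClass`)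
# (crux `FInjectiveMacaulayfication` stmt-ResolutionOfSingularities-15315, chain w45a; seat res-L1-w45a-stub-2 g12; res-L1-w45a-plan-1 GO 2026-08-29T02:44:48Z
# «the H_F class level over EVERY field of characteristic p … then thin any-field rows per census bed»)

[OURS · L1 W4.5a] Support file (`--supports stmt-ResolutionOfSingularities-15315 --as helper`); def-free, unconditional; replaces the role of NO printed item; NOT a statement
of the manuscript; AI-written (AI review is weaker than expert review). OURS counted 0; nothing of the crux is proved.

Every theorem of ✓ `…Sigma3P2d4BPointFloorRowClass` that carried `[IsAlgClosed k]` is re-proved here WITHOUT it, for EVERY field `k` of characteristic 2: the callees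
`FHalfRowOfNewtonNondegenerate.*` / `F108ClassRow.*_of_convenient*` (k = k̄) are swapped for this seat's any-field twins `FHalfRowAnyField.*_of_geomWeaklyNondegenerate` /
`F108ClassRowAnyField.*_of_convenient_anyField*` (✓ `…FHalfRowOfWeaklyNondegenerateAnyField`, ✓ `…F108ClassRowAnyField`), whose one changed hypothesis — GEOMETRIC weak
non-degeneracy, i.e. weak non-degeneracy of `map (algebraMap k K) f` over an algebraically closed `K ⊇ k` — is supplied by the bed's field-general Specimen lemma
`Sigma3P2d4BSpecimen.weaklyNondegenerate` at `K := AlgebraicClosure k` (`geom_weaklyNondegenerate`). The field-general lemmas of the original file (strict transforms, shift identity,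
convenience, input side LEGAL / NOT FULL) are imported, not restated. Proof texts are otherwise the originals byte-for-byte.
SCOPE (desk caveat, binding): the vertex is the `k`-RATIONAL origin; closed points with residue field a proper extension of `k` are not addressed (GAP-2).
[OURS · thin application of landed theorems] [cite: IshiiSingularities2018, Thm. 4.4.23; Fedder1983, Thm. 1.12; StacksProject, Tag 080A; GortzWedhorn2020, Prop. 13.91 (2), (13.19)]
-/

-- single-problem summit: the doubled namespace component is forced
set_option linter.dupNamespace false

noncomputable section

open AlgebraicGeometry CategoryTheory Literature.AlgebraicGeometry.Resolution TopologicalSpace IsLocalRing MvPolynomial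

namespace Summit.ResolutionOfSingularities.ResolutionOfSingularities.Theorems.FInjectiveMacaulayfication.Sigma3P2d4BPointFloorRowAnyField

open Summit.ResolutionOfSingularities.ResolutionOfSingularities.Theorems.FInjectiveMacaulayfication
open SliceableCentre GermForm FanCheckKit Sigma3P2d4BNewtonKFan
open Literature.AlgebraicGeometry.Resolution.BoubakriGreuelMarkwig Sigma3P2d4BPointFloorRowClass

/-- **GEOMETRIC weak non-degeneracy of the (shifted) bed over ANY field of characteristic 2**: the Specimen lemma `Sigma3P2d4BSpecimen.weaklyNondegenerate`, stated for every field of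
characteristic 2, applied over `AlgebraicClosure k` to `map (algebraMap k _) f` (which is the same polynomial expression). [OURS · plumbing] -/
theorem geom_weaklyNondegenerate (k : Type) [Field k] [CharP k 2] (f : MvPolynomial (Fin 5) k)
    (hf : f = X 4 ^ 2 + X 0 ^ 2 * X 4 + X 0 ^ 5 + X 0 ^ 6 + X 1 ^ 3 + X 2 ^ 3 + X 3 ^ 5) :
    ∀ w : Fin 5 → ℝ, (∀ i, 0 < w i) →
      IsWeaklyNondegenerateAlong w ((map (algebraMap k (AlgebraicClosure k)) f : MvPolynomial (Fin 5) (AlgebraicClosure k)) :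
        MvPowerSeries (Fin 5) (AlgebraicClosure k)) := by
  haveI : CharP (AlgebraicClosure k) 2 := charP_of_injective_algebraMap (algebraMap k (AlgebraicClosure k)).injective 2
  refine Sigma3P2d4BSpecimen.weaklyNondegenerate (AlgebraicClosure k) _ ?_
  subst hf
  simp


/-- ANY-FIELD TWIN (GAP-2 «k ≠ k̄»; `[IsAlgClosed k]` dropped, geometric weak non-degeneracy via `AlgebraicClosure k`): ★ **`Bl_{𝔪·K} X′` IS FULL AT EVERY POINT** (class route: weak non-degeneracy + Newton fan cover data; no Fedder cell). [OURS · certificate instance]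
[cite: IshiiSingularities2018, Thm. 4.4.23 and Cor. 4.4.25] -/
theorem affineBlowup_mK_fullCl_anyField (k : Type) [Field k] [CharP k 2] (f : MvPolynomial (Fin 5) k)
    (hf : f = X 4 ^ 2 + X 0 ^ 2 * X 4 + X 0 ^ 5 + X 0 ^ 6 + X 1 ^ 3 + X 2 ^ 3 + X 3 ^ 5) :
    ∀ y : ↥(affineBlowup (Ideal.span ((fun e : Fin 5 →₀ ℕ => Ideal.Quotient.mk (Ideal.span {f}) (monomial e (1 : k))) '' (genSet 5 AL2 : Set (Fin 5 →₀ ℕ))))),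
      FullCl 2 ((affineBlowup (Ideal.span ((fun e : Fin 5 →₀ ℕ => Ideal.Quotient.mk (Ideal.span {f}) (monomial e (1 : k))) '' (genSet 5 AL2 : Set (Fin 5 →₀ ℕ))))).presheaf.stalk y) := by
  classical
  haveI : Fact (Nat.Prime 2) := ⟨Nat.prime_two⟩
  choose g hθ hg0 using exists_refining_strictTransform k f hf
  exact FHalfRowAnyField.affineBlowup_fullCl_of_geomWeaklyNondegenerate 2 k (AlgebraicClosure k) f (Sigma3P2d4BSpecimen.prime_f k f hf)
    (geom_weaklyNondegenerate k f hf) (Sigma3P2d4BSpecimen.mk_X_ne_zero k f hf)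
    (fun x hx => Sigma3P2d4BSpecimen.regular_off_vertex k f hf x.asIdeal hx)
    (genSet 5 AL2) hprimAJ.2.1 hprimAJ.1 131 (chartM 5 AL2 CL 131) (hcov k) Vq hV (chartA 5 AL2 CL 131) haA hgen hge g _ hθ hg0 (Sigma3P2d4BNewtonKFan.hv k _)

/-- ANY-FIELD TWIN (GAP-2 «k ≠ k̄»; `[IsAlgClosed k]` dropped, geometric weak non-degeneracy via `AlgebraicClosure k`): ★★ **THE POINT FLOOR OF `V(f′)` IS CURED — BY THE CLASS THEOREM** (`k` ANY field, char 2). See the module docstring. [OURS · certificate instance]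
[cite: IshiiSingularities2018, Thm. 4.4.23 and Cor. 4.4.25] [cite: StacksProject, Tag 080A] -/
theorem pointFloor_sigma3B_row_anyField (k : Type) [Field k] [CharP k 2] (f : MvPolynomial (Fin 5) k)
    (hf : f = X 4 ^ 2 + X 0 ^ 2 * X 4 + X 0 ^ 5 + X 0 ^ 6 + X 1 ^ 3 + X 2 ^ 3 + X 3 ^ 5)
    (v : Spec (.of (MvPolynomial (Fin 5) k ⧸ Ideal.span {f})))
    (hv : v.asIdeal = Ideal.span (Set.range (fun j : Fin 5 => Ideal.Quotient.mk (Ideal.span {f}) (X j)))) :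
    ∀ (S' : Scheme.{0}) (g : S' ⟶ Spec ((Spec (.of (MvPolynomial (Fin 5) k ⧸ Ideal.span {f}))).presheaf.stalk v)),
      IsBlowup g ((affineBlowup.idealSheaf (Ideal.span (Set.range (fun j : Fin 5 => Ideal.Quotient.mk (Ideal.span {f}) (X j))))).comap
        ((Spec (.of (MvPolynomial (Fin 5) k ⧸ Ideal.span {f}))).fromSpecStalk v)) →
      ∃ 𝓚 : S'.IdealSheafData, 𝓚 ≠ ⊥ ∧
        (∀ s ∈ (𝓚.support : Set S'), g.base s = closedPoint ((Spec (.of (MvPolynomial (Fin 5) k ⧸ Ideal.span {f}))).presheaf.stalk v)) ∧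
        ∀ (S'' : Scheme.{0}) (π : S'' ⟶ S'), IsBlowup π 𝓚 → ∀ s : S'', FullCl 2 (S''.presheaf.stalk s) := by
  classical
  haveI : Fact (Nat.Prime 2) := ⟨Nat.prime_two⟩
  choose g hθ hg0 using exists_refining_strictTransform k f hf
  exact FHalfRowAnyField.fHalfRow_of_geomWeaklyNondegenerate 2 k (AlgebraicClosure k) (by norm_num) f (Sigma3P2d4BSpecimen.prime_f k f hf)
    (geom_weaklyNondegenerate k f hf) (Sigma3P2d4BSpecimen.mk_X_ne_zero k f hf)
    (fun x hx => Sigma3P2d4BSpecimen.regular_off_vertex k f hf x.asIdeal hx)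
    (genSet 5 AL2) (genSet 5 KL2) (span_A_eq_floor_mul_K k _).1 hKprim.1 hprimAJ.2.1 hprimAJ.1 131 (chartM 5 AL2 CL 131) (hcov k) Vq hV
    (chartA 5 AL2 CL 131) haA hgen hge g _ hθ hg0 (Sigma3P2d4BNewtonKFan.hv k _) v hv

/-- ANY-FIELD TWIN (GAP-2 «k ≠ k̄»; `[IsAlgClosed k]` dropped, geometric weak non-degeneracy via `AlgebraicClosure k`): ★★ **THE TWO-SIDED ROW FOR `V(f′)` AT THE POINT FLOOR: LEGAL ∧ NOT F(4)-iso (p = 2) ∧ CURED** (`k` ANY field). The first two conjuncts are this seatʼs `Sigma3P2d4BPointFloor`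
(input side), the third is §2. [OURS · assembly of landed theorems] -/
theorem f4pos_row_sigma3B_anyField (k : Type) [Field k] [CharP k 2] (f : MvPolynomial (Fin 5) k)
    (hf : f = X 4 ^ 2 + X 0 ^ 2 * X 4 + X 0 ^ 5 + X 0 ^ 6 + X 1 ^ 3 + X 2 ^ 3 + X 3 ^ 5)
    (v : Spec (.of (MvPolynomial (Fin 5) k ⧸ Ideal.span {f})))
    (hv : v.asIdeal = Ideal.span (Set.range (fun j : Fin 5 => Ideal.Quotient.mk (Ideal.span {f}) (X j))))
    (S' : Scheme.{0}) (g : S' ⟶ Spec ((Spec (.of (MvPolynomial (Fin 5) k ⧸ Ideal.span {f}))).presheaf.stalk v))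
    (hg : IsBlowup g ((affineBlowup.idealSheaf (Ideal.span (Set.range (fun j : Fin 5 => Ideal.Quotient.mk (Ideal.span {f}) (X j))))).comap
      ((Spec (.of (MvPolynomial (Fin 5) k ⧸ Ideal.span {f}))).fromSpecStalk v))) :
    (((affineBlowup.idealSheaf (Ideal.span (Set.range (fun j : Fin 5 => Ideal.Quotient.mk (Ideal.span {f}) (X j))))).comap
        ((Spec (.of (MvPolynomial (Fin 5) k ⧸ Ideal.span {f}))).fromSpecStalk v)) ≠ ⊥ ∧
      (((((affineBlowup.idealSheaf (Ideal.span (Set.range (fun j : Fin 5 => Ideal.Quotient.mk (Ideal.span {f}) (X j))))).comap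
        ((Spec (.of (MvPolynomial (Fin 5) k ⧸ Ideal.span {f}))).fromSpecStalk v))).support :
          Set (Spec ((Spec (.of (MvPolynomial (Fin 5) k ⧸ Ideal.span {f}))).presheaf.stalk v))) ⊆
        (Scheme.regularLocus (Spec ((Spec (.of (MvPolynomial (Fin 5) k ⧸ Ideal.span {f}))).presheaf.stalk v)))ᶜ) ∧
      (∀ s : S', g.base s ≠ closedPoint ((Spec (.of (MvPolynomial (Fin 5) k ⧸ Ideal.span {f}))).presheaf.stalk v) → s ∈ Scheme.regularLocus S') ∧
      (∀ s : S', CMCl (S'.presheaf.stalk s))) ∧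
    (∃ s : S', g.base s = closedPoint ((Spec (.of (MvPolynomial (Fin 5) k ⧸ Ideal.span {f}))).presheaf.stalk v) ∧ ¬ FullCl 2 (S'.presheaf.stalk s)) ∧
    (∃ 𝓚 : S'.IdealSheafData, 𝓚 ≠ ⊥ ∧
      (∀ s ∈ (𝓚.support : Set S'), g.base s = closedPoint ((Spec (.of (MvPolynomial (Fin 5) k ⧸ Ideal.span {f}))).presheaf.stalk v)) ∧
      ∀ (S'' : Scheme.{0}) (π : S'' ⟶ S'), IsBlowup π 𝓚 → ∀ s : S'', FullCl 2 (S''.presheaf.stalk s)) :=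
  ⟨Sigma3P2d4BPointFloor.pointFloor_sigma3B_input_legal k f hf v hv S' g hg, Sigma3P2d4BPointFloor.pointFloor_sigma3B_not_full k f hf v hv S' g hg,
    pointFloor_sigma3B_row_anyField k f hf v hv S' g hg⟩

/-- ANY-FIELD TWIN (GAP-2 «k ≠ k̄»; `[IsAlgClosed k]` dropped, geometric weak non-degeneracy via `AlgebraicClosure k`): ★ **`FInjectivizationGermAt 2 v` AT THE VERTEX OF `V(f′)`** (`k` ANY field, char 2): one `𝔪`-primary monomial blowing up of `Spec 𝒪_{X′,v}` (along `𝔪·K`) is FULL at every stalk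
(§1 + ✓ `GermOfGlobalBlowup.fInjectivizationGermAt_of_affineBlowup`). [OURS · certificate instance; cite: GortzWedhorn2020, Prop. 13.91 (2)] -/
theorem sigma3B_fInjectivizationGermAt_anyField (k : Type) [Field k] [CharP k 2] (f : MvPolynomial (Fin 5) k)
    (hf : f = X 4 ^ 2 + X 0 ^ 2 * X 4 + X 0 ^ 5 + X 0 ^ 6 + X 1 ^ 3 + X 2 ^ 3 + X 3 ^ 5)
    (v : Spec (.of (MvPolynomial (Fin 5) k ⧸ Ideal.span {f})))
    (hv : v.asIdeal = Ideal.span (Set.range (fun j : Fin 5 => Ideal.Quotient.mk (Ideal.span {f}) (X j)))) :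
    FInjectivizationGermAt 2 v := by
  classical
  haveI hp : (Ideal.span {f}).IsPrime := Sigma3P2d4BSpecimen.isPrime_span_f k f hf
  haveI : IsDomain (MvPolynomial (Fin 5) k ⧸ Ideal.span {f}) := Ideal.Quotient.isDomain _
  have hpow : ∀ j : Fin 5, ∃ N : ℕ, (Ideal.Quotient.mk (Ideal.span {f}) (X j)) ^ N ∈
      Ideal.span ((fun e : Fin 5 →₀ ℕ => Ideal.Quotient.mk (Ideal.span {f}) (monomial e (1 : k))) '' (genSet 5 AL2 : Set (Fin 5 →₀ ℕ))) := by
    intro j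
    obtain ⟨N, hN⟩ := hprimAJ.2.1 j (Finset.mem_univ j)
    refine ⟨N, ?_⟩
    have e : (Ideal.Quotient.mk (Ideal.span {f}) (X j)) ^ N = Ideal.Quotient.mk (Ideal.span {f}) (monomial (Finsupp.single j N) (1 : k)) := by
      rw [← map_pow, X_pow_eq_monomial]
    rw [e]
    exact Ideal.subset_span ⟨_, Finset.mem_coe.mpr hN, rfl⟩
  refine GermOfGlobalBlowup.fInjectivizationGermAt_of_affineBlowup 2 _ ?_ v ?_ (affineBlowup_mK_fullCl_anyField k f hf)
  · obtain ⟨N, hN⟩ := hpow 0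
    intro hbot
    rw [hbot, Ideal.mem_bot] at hN
    exact pow_ne_zero N (Sigma3P2d4BSpecimen.mk_X_ne_zero k f hf 0) hN
  · rw [hv, Ideal.span_le]
    rintro _ ⟨j, rfl⟩
    obtain ⟨N, hN⟩ := hpow j
    exact ⟨N, hN⟩

/-- ANY-FIELD TWIN (GAP-2 «k ≠ k̄»; `[IsAlgClosed k]` dropped, geometric weak non-degeneracy via `AlgebraicClosure k`): ★★★ **THE POINT-FLOOR ROW OF P2d4B `z² + x²z + y³ + u³ + t⁵` (char 2, `k` ANY field) — LEGAL ∧ NOT F(4)-iso ∧ CURED — BY THE CLASS ROUTE**: §3 for `f′ = σ₃ f` transported along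
`σ : z ↦ z + x³` by res-L1-w45a-stub-1ʼs `PolyAutRowTransport.exists_translate` / `pointFloorRow_of_algEquiv`. [OURS · assembly of landed theorems; cite: GortzWedhorn2020, (13.19)] -/
theorem pointFloorRow_P2d4B_anyField (k : Type) [Field k] [CharP k 2] (f : MvPolynomial (Fin 5) k)
    (hf : f = X 4 ^ 2 + X 0 ^ 2 * X 4 + X 1 ^ 3 + X 2 ^ 3 + X 3 ^ 5) :
    ∀ (v' : Spec (.of (MvPolynomial (Fin 5) k ⧸ Ideal.span {f}))),
      v'.asIdeal = Ideal.span (Set.range fun j : Fin 5 => Ideal.Quotient.mk (Ideal.span {f}) (X j)) →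
      ∀ (S' : Scheme.{0}) (g₁ : S' ⟶ Spec ((Spec (.of (MvPolynomial (Fin 5) k ⧸ Ideal.span {f}))).presheaf.stalk v')),
        IsBlowup g₁ ((affineBlowup.idealSheaf (Ideal.span (Set.range fun j : Fin 5 => Ideal.Quotient.mk (Ideal.span {f}) (X j)))).comap
          ((Spec (.of (MvPolynomial (Fin 5) k ⧸ Ideal.span {f}))).fromSpecStalk v')) →
        (((affineBlowup.idealSheaf (Ideal.span (Set.range fun j : Fin 5 => Ideal.Quotient.mk (Ideal.span {f}) (X j)))).comap
            ((Spec (.of (MvPolynomial (Fin 5) k ⧸ Ideal.span {f}))).fromSpecStalk v')) ≠ ⊥ ∧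
          ((((affineBlowup.idealSheaf (Ideal.span (Set.range fun j : Fin 5 => Ideal.Quotient.mk (Ideal.span {f}) (X j)))).comap
            ((Spec (.of (MvPolynomial (Fin 5) k ⧸ Ideal.span {f}))).fromSpecStalk v')).support :
              Set (Spec ((Spec (.of (MvPolynomial (Fin 5) k ⧸ Ideal.span {f}))).presheaf.stalk v'))) ⊆
            (Scheme.regularLocus (Spec ((Spec (.of (MvPolynomial (Fin 5) k ⧸ Ideal.span {f}))).presheaf.stalk v')))ᶜ) ∧
          (∀ s : S', g₁.base s ≠ closedPoint _ → s ∈ Scheme.regularLocus S') ∧ (∀ s : S', CMCl (S'.presheaf.stalk s))) ∧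
        (∃ s : S', g₁.base s = closedPoint _ ∧ ¬ FullCl 2 (S'.presheaf.stalk s)) ∧
        (∃ 𝓚 : S'.IdealSheafData, 𝓚 ≠ ⊥ ∧ (∀ s ∈ (𝓚.support : Set S'), g₁.base s = closedPoint _) ∧
          ∀ (S'' : Scheme.{0}) (π : S'' ⟶ S'), IsBlowup π 𝓚 → ∀ s : S'', FullCl 2 (S''.presheaf.stalk s)) :=
  by
  obtain ⟨φ, hφ, h₁, h₂⟩ := PolyAutRowTransport.exists_translate k (0 : Fin 5) 4 (by decide) (1 : k) 3 (by norm_num)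
  exact PolyAutRowTransport.pointFloorRow_of_algEquiv k 2 φ h₁ h₂ f _ (by rw [hφ]; exact aeval_shift k f _ hf rfl)
    (fun v hv S' g₁ hg₁ => f4pos_row_sigma3B_anyField k _ rfl v hv S' g₁ hg₁)

/-- ANY-FIELD TWIN (GAP-2 «k ≠ k̄»; `[IsAlgClosed k]` dropped, geometric weak non-degeneracy via `AlgebraicClosure k`): ★★★ **`FInjectivizationGermAt 2 v` AT THE VERTEX OF P2d4B, BY THE CLASS ROUTE** (`k` ANY field, char 2): §4 for `f′` transported by `PolyAutRowTransport.fInjectivizationGermAt_of_algEquiv` —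
a second, independent kernel proof of the germ conclusion of ✓ p612829 `P2d4BChar2Germ`. [OURS · assembly of landed theorems; cite: GortzWedhorn2020, (13.19)] -/
theorem p2d4b_fInjectivizationGermAt_anyField (k : Type) [Field k] [CharP k 2] (f : MvPolynomial (Fin 5) k)
    (hf : f = X 4 ^ 2 + X 0 ^ 2 * X 4 + X 1 ^ 3 + X 2 ^ 3 + X 3 ^ 5) :
    ∀ v' : Spec (.of (MvPolynomial (Fin 5) k ⧸ Ideal.span {f})),
      v'.asIdeal = Ideal.span (Set.range fun j : Fin 5 => Ideal.Quotient.mk (Ideal.span {f}) (X j)) → FInjectivizationGermAt 2 v' :=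
  by
  obtain ⟨φ, hφ, h₁, h₂⟩ := PolyAutRowTransport.exists_translate k (0 : Fin 5) 4 (by decide) (1 : k) 3 (by norm_num)
  exact PolyAutRowTransport.fInjectivizationGermAt_of_algEquiv k 2 φ h₁ h₂ f _ (by rw [hφ]; exact aeval_shift k f _ hf rfl)
    (fun v hv => sigma3B_fInjectivizationGermAt_anyField k _ rfl v hv)

end Summit.ResolutionOfSingularities.ResolutionOfSingularities.Theorems.FInjectiveMacaulayfication.Sigma3P2d4BPointFloorRowAnyField

end
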